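/-
Copyright: lit-balaban Phase-2 proof seat p31.  Statement-level skeleton of a published paper; no proof claims beyond what the
kernel checks below.
-/
import Literature.MathematicalPhysics.QuantumFieldTheory.BalabanImbrieJaffe1984to88.BIJ85Eq219Proof
import Literature.MathematicalPhysics.QuantumFieldTheory.BalabanImbrieJaffe1984to88.BIJ85CellAverages

/-!
# `BalabanImbrieJaffe1984to88.BIJ85Eq219ProofPart2` — T. Bałaban, J. Imbrie, A. Jaffe, *Renormalization of the Higgs model:
minimizers, propagators and the stability of mean field theory*, Commun. Math. Phys. **97** (1985) 299–329
[BalabanImbrieJaffe1985]: **(2.19)** `Q Q^{s*} = I` on the tori, part 2 — the uniform cell carrier and the full linear average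

statement-level skeleton of published theorems with citation tags; proofs where landed; nothing here is a claim about the Yang–Mills mass gap

PDF held: `paper:balaban1985-cmp97-bij-higgs-minimizers` (journal page = PDF page + 298).  Pages read as images: see part 1
(`BIJ85Eq219Proof`), pp. 303–305.

CITATION HEADER (lean-in-tree rule).  Part of the lit-balaban TYPED SKELETON (HOME `run/shared/lean/pub/lit-balaban/`), Phase-2
seat p31, row **C1.Eq2.19** of `HOME/SKELETON.md`; continuation of `BIJ85Eq219Proof` (which PROVES (2.19) `bondAvg (Q^{s*}B) = B`
for Q = (2.13) = `LatticeFieldCalculus.bondAvg` and Q^{s*} = (2.17) = `BlockBonds.Qsstar` on the torus geometry `torusBlockBonds`,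
and the count `|B^s(b′)| = L^{d−1}`).  WHAT IS REPRODUCED HERE, and how:
* the SAME identities for the uniform cell carrier `BIJ85CellAverages.Cells` (exponent m = 1; row C1.Eq2.20-2.23 re-obtains
  (2.16)–(2.18) as its case m = 1): the torus instance `torusSurfaceCells` (fine cells = bonds of `T^{(j)}`, coarse cells = bonds
  of `T^{(j+1)}`) has the surface sets (2.15) as its block sets (`mem_cellsB_iff`), `Cells.Qstar = BlockBonds.Qsstar` on the tori
  (`cellsQstar_eq_Qsstar`), hence **(2.19)** `bondAvg (Cells.Qstar B) = B` (`bondAvg_cellsQstar`) and (2.18) = (2.23) at m = 1,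
  `Q Q^* = L·I`, outright (`cellsQ_Qstar_torus`, count `card_cellsB`);
* **(2.19)** for the FULL linear average `LatticeFieldCalculus.fullBondAvg` = [Balaban1984PropagatorsI] (1.8) (the average
  with the staircase legs `Γ_{c₋,x}`, `Γ_{x(c),c₊}` to the block centres, which reduces to (2.13) in the axial gauge): every bond
  of a staircase `Γ_{y,x}`, `x ∈ B(y)`, has both endpoints in `B(y)` (`stairSum_eq_zero_of_interior`), `Q^{s*}B` vanishes on such
  interior bonds ((2.17), second case), so `fullBondAvg (Q^{s*}B) = bondAvg (Q^{s*}B) = B` (`fullBondAvg_eq_bondAvg_of_interior`,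
  `fullBondAvg_Qsstar`; for the uniform carrier `fullBondAvg_cellsQstar` — the `fullBondAvg` ↔ `Cells.Qstar` wording of
  `PHASE2-TARGETS.md` §G.3).
Standing range `j + 1 ≤ m + K` of `Setup` throughout (hypothesis `hj`).  Unit `lit-balaban-p31` (literature-prover-lit-balaban-p31-0),
2026-08-21.
-/

open scoped BigOperators

namespace Literature.MathematicalPhysics.QuantumFieldTheory.BalabanImbrieJaffe1984to88.BIJ85Eq219ProofPart2

open Literature.MathematicalPhysics.QuantumFieldTheory.Balaban1983to89
open BIJ85Sect2SurfaceAverages BIJ85CellAverages LatticeFieldCalculus BIJ85Eq219Proof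

variable {P : Params} {j : ℕ}

/-! ## 1. The same on the uniform cell carrier `Cells` (m = 1) of `BIJ85CellAverages` -/

/-- The surface-bond instance (m = 1) of the uniform cell geometry `BIJ85CellAverages.Cells` ON THE TORI: fine cells = bonds of
`T^{(j)}`, coarse cells = bonds of `T^{(j+1)}`, `cell b = some ⟨blockOf b₋, dir b⟩` for a bond crossing two blocks and `none` for an
interior bond (both endpoints in one block), exponent `m = 1` ((2.16)–(2.18) = the case m = 1 of (2.21)–(2.23)).
[cite: BalabanImbrieJaffe1985, (2.16) p.304] -/
@[reducible] noncomputable def torusSurfaceCells (P : Params) (j : ℕ) : Cells where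
  F := PBond P j
  C := PBond P (j + 1)
  fF := inferInstance
  fC := inferInstance
  dF := Classical.decEq _
  dC := Classical.decEq _
  cell b := if blockOf b.src = blockOf b.tgt then none else some ⟨blockOf b.src, b.dir⟩
  L := P.L
  d := P.d
  m := 1
  one_le_L := by have := P.hL.2; omega
  m_le_d := P.hd

/-- kernel: the block sets of `torusSurfaceCells` ARE the surface sets (2.15) of `torusBlockBonds` (standing range).
[cite: BalabanImbrieJaffe1985, (2.15) p.304] -/
theorem mem_cellsB_iff (hj : j + 1 ≤ P.m + P.K) (c : PBond P (j + 1)) (b : PBond P j) :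
    b ∈ (torusSurfaceCells P j).B c ↔ b ∈ (torusBlockBonds P j).Bs c := by
  refine ((torusSurfaceCells P j).mem_B c b).trans (Iff.trans ?_ (mem_Bs_iff c b).symm)
  show (if blockOf b.src = blockOf b.tgt then none else some (⟨blockOf b.src, b.dir⟩ : PBond P (j + 1))) = some c ↔
    blockOf b.src = c.src ∧ blockOf b.tgt = c.tgt
  by_cases hint : blockOf b.src = blockOf b.tgt
  · rw [if_pos hint]
    simp only [reduceCtorEq, false_iff, not_and]
    intro h1 h2
    exact (torusBlockBonds P j).cbond_ne c (h1.symm.trans (hint.trans h2))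
  · rw [if_neg hint, Option.some.injEq]
    have htgt : blockOf b.tgt = (blockOf b.src).shift b.dir :=
      (blockOf_tgt hj b).resolve_left (fun h => hint h.symm)
    constructor
    · rintro rfl
      exact ⟨rfl, htgt⟩
    · rintro ⟨h1, h2⟩
      exact (torusBlockBonds P j).cbond_ext ⟨blockOf b.src, b.dir⟩ c h1 (htgt.symm.trans h2)

/-- kernel: on the tori the uniform-carrier adjoint `Cells.Qstar` (m = 1, (2.22)/(2.17)) and `BlockBonds.Qsstar` (2.17) are
the same operator. [cite: BalabanImbrieJaffe1985, (2.17) p.304] -/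
theorem cellsQstar_eq_Qsstar (hj : j + 1 ≤ P.m + P.K) (B : PBond P (j + 1) → ℝ) :
    (torusSurfaceCells P j).Qstar B = (torusBlockBonds P j).Qsstar B := by
  funext b
  unfold Cells.Qstar BlockBonds.Qsstar
  refine Finset.sum_congr rfl fun c _ => ?_
  exact @if_congr ℝ _ _ (_) (_) _ _ _ _ (mem_cellsB_iff hj c b)
    (by show (P.L : ℝ) ^ 1 * B c = (P.L : ℝ) * B c; rw [pow_one]) rfl

/-- **(2.19)** once more, for the uniform cell carrier of `BIJ85CellAverages` (m = 1): `bondAvg (Cells.Qstar B) = B` on the tori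
(standing range). [cite: BalabanImbrieJaffe1985, (2.19) p.305] -/
theorem bondAvg_cellsQstar (hj : j + 1 ≤ P.m + P.K) (B : PBond P (j + 1) → ℝ) :
    bondAvg (V := ℝ) ((torusSurfaceCells P j).Qstar B) = B := by
  rw [cellsQstar_eq_Qsstar hj]
  exact bondAvg_Qsstar hj B

/-- kernel: the block sets of the uniform carrier have the printed size `L^{d−m}` = `L^{d−1}` on the tori (standing range).
[cite: BalabanImbrieJaffe1985, (2.18) p.304] -/
theorem card_cellsB (hj : j + 1 ≤ P.m + P.K) (c : PBond P (j + 1)) :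
    ((torusSurfaceCells P j).B c).card = P.L ^ (P.d - 1) := by
  have h : (torusSurfaceCells P j).B c = (torusBlockBonds P j).Bs c := Finset.ext fun b => mem_cellsB_iff hj c b
  exact (congrArg Finset.card h).trans (card_Bs hj c)

/-- **(2.18)**/(2.23) at m = 1, *"Q^sQ^{s*} = LI"*, outright for the uniform carrier on the tori (`Cells.Q_Qstar` with its count
hypothesis discharged by `card_cellsB`). [cite: BalabanImbrieJaffe1985, (2.18) p.304] -/
theorem cellsQ_Qstar_torus (hj : j + 1 ≤ P.m + P.K) (B : PBond P (j + 1) → ℝ) (c : PBond P (j + 1)) :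
    (torusSurfaceCells P j).Q ((torusSurfaceCells P j).Qstar B) c = (P.L : ℝ) * B c := by
  have h : (torusSurfaceCells P j).Q ((torusSurfaceCells P j).Qstar B) c = (P.L : ℝ) ^ 1 * B c :=
    (torusSurfaceCells P j).Q_Qstar (card_cellsB hj) B c
  rw [h, pow_one]

/-! ## 2. (2.19) for the full linear average (1.8) of [Balaban1984PropagatorsI]: the staircase legs are interior -/

/-- The centred offset of a block site from the block centre, read by `ZMod.valMinAbs` as `stairSum` does, is the printed
`n_μ = r_μ − (L−1)/2`, `|n_μ| ≤ (L−1)/2` (standing range: `N_j = L·N_{j+1} > 2|n_μ|`). [folklore] -/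
private theorem valMinAbs_blockSite_sub_emb (hj : j + 1 ≤ P.m + P.K) (y : Site P (j + 1)) (r : Fin P.d → Fin P.L)
    (μ : Fin P.d) :
    (Site.blockSite y r μ - emb y μ).valMinAbs = (r μ : ℤ) - (((P.L - 1) / 2 : ℕ) : ℤ) := by
  apply (ZMod.valMinAbs_spec _ _).mpr
  have hL := AveragingRT.two_mul_half_add_one P
  have hN : P.L ≤ P.sitesPerDir j := by
    rw [P.sitesPerDir_eq_mul_succ hj]
    exact Nat.le_mul_of_pos_left P.L (Nat.pos_of_ne_zero (P.sitesPerDir_ne_zero (j + 1)))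
  have hr := (r μ).isLt
  refine ⟨?_, ?_⟩
  · simp only [Site.blockSite, emb, Nat.cast_add, Nat.cast_mul, Int.cast_sub, Int.cast_natCast]
    ring
  · simp only [Set.mem_Ioc]
    have hN' : ((P.L : ℕ) : ℤ) ≤ ((P.sitesPerDir j : ℕ) : ℤ) := by exact_mod_cast hN
    constructor <;> push_cast <;> omega

/-- The corner of the staircase `Γ_{y,x}` (`mixSite`) between the block centre `emb y` and `x = blockSite y r` is itself a site of
`B(y)`: offsets `r_ν` in the coordinates already changed, `(L−1)/2` in the others. [folklore] -/
private theorem mixSite_emb_blockSite (y : Site P (j + 1)) (r : Fin P.d → Fin P.L) (μ : Fin P.d) :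
    mixSite μ (emb y) (Site.blockSite y r)
      = Site.blockSite y (fun ν => if μ < ν then r ν else ⟨(P.L - 1) / 2, AveragingRT.half_lt P⟩) := by
  funext ν
  by_cases h : μ < ν
  · simp only [mixSite, if_pos h, Site.blockSite]
  · simp only [mixSite, if_neg h, Site.blockSite, emb]

/-- Stepping BACK `u ≤ r_μ` sites from `blockSite y r` in the direction `μ` stays in `B(y)`, at offset `r_μ − u`. [folklore] -/
private theorem update_blockSite_sub (y : Site P (j + 1)) (r : Fin P.d → Fin P.L) (μ : Fin P.d) {u : ℕ}
    (hu : u ≤ (r μ : ℕ)) :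
    Function.update (Site.blockSite y r) μ (Site.blockSite y r μ - (u : ZMod (P.sitesPerDir j)))
      = Site.blockSite y (Function.update r μ ⟨r μ - u, by have := (r μ).isLt; omega⟩) := by
  funext ν
  by_cases hν : ν = μ
  · subst hν
    simp only [Function.update_self, Site.blockSite]
    rw [show (y ν).val * P.L + ((r ν : ℕ) - u) = ((y ν).val * P.L + (r ν : ℕ)) - u by omega,
      Nat.cast_sub (by omega)]
  · simp only [Function.update_of_ne hν, Site.blockSite]

/-- THE STAIRCASE LEGS ARE INTERIOR: for a bond field `A` vanishing on the interior bonds of the block `B(y)` (both endpoints in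
`B(y)`), `A(Γ_{y,x}) = 0` for every `x ∈ B(y)` — every bond of the staircase `Γ_{y,x}` from the centre `emb y` to `x = blockSite y r`
has both endpoints in `B(y)` (centred blocks, `|n_μ| ≤ (L−1)/2`; standing range). [cite: Balaban1984PropagatorsI, (1.8) p.19] -/
theorem stairSum_eq_zero_of_interior (hj : j + 1 ≤ P.m + P.K) {V : Type*} [AddCommGroup V] [Module ℝ V]
    {A : VecField P j V} (y : Site P (j + 1))
    (hA : ∀ b : PBond P j, blockOf b.src = y → blockOf b.tgt = y → A b = 0) (r : Fin P.d → Fin P.L) :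
    stairSum A (emb y) (Site.blockSite y r) = 0 := by
  unfold stairSum
  refine Finset.sum_eq_zero fun μ _ => ?_
  rw [valMinAbs_blockSite_sub_emb hj y r μ, mixSite_emb_blockSite y r μ]
  set r' : Fin P.d → Fin P.L := fun ν => if μ < ν then r ν else ⟨(P.L - 1) / 2, AveragingRT.half_lt P⟩ with hr'
  have hr'μ : (r' μ : ℕ) = (P.L - 1) / 2 := by simp [hr']
  have hr := (r μ).isLt
  have hL := P.hL.2
  by_cases hsign : ((P.L - 1) / 2 : ℕ) ≤ (r μ : ℕ)
  · -- forward run of `k = r_μ − (L−1)/2` steps: offsets `(L−1)/2 + t`, `t ≤ k`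
    obtain ⟨k, hk⟩ : ∃ k : ℕ, (r μ : ℕ) = (P.L - 1) / 2 + k := ⟨(r μ : ℕ) - (P.L - 1) / 2, by omega⟩
    have hcast : ((r μ : ℕ) : ℤ) - (((P.L - 1) / 2 : ℕ) : ℤ) = ((k : ℕ) : ℤ) := by omega
    rw [hcast, runSum_ofNat]
    unfold segSum
    refine Finset.sum_eq_zero fun t ht => ?_
    have htk := Finset.mem_range.mp ht
    apply hA
    · show blockOf (runSite (Site.blockSite y r') μ t) = y
      exact blockOf_runSite_blockSite_of_lt hj y r' μ (by omega)
    · show blockOf ((runSite (Site.blockSite y r') μ t).shift μ) = y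
      rw [← runSite_succ]
      exact blockOf_runSite_blockSite_of_lt hj y r' μ (by omega)
  · -- backward run of `k + 1 = (L−1)/2 − r_μ` steps: offsets `(L−1)/2 − (t+1)`, `t ≤ k`
    push Not at hsign
    obtain ⟨k, hk⟩ : ∃ k : ℕ, (P.L - 1) / 2 = (r μ : ℕ) + k + 1 := ⟨(P.L - 1) / 2 - (r μ : ℕ) - 1, by omega⟩
    have hcast : ((r μ : ℕ) : ℤ) - (((P.L - 1) / 2 : ℕ) : ℤ) = Int.negSucc k := by rw [Int.negSucc_eq]; omega
    rw [hcast]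
    simp only [runSum, neg_eq_zero]
    refine Finset.sum_eq_zero fun t ht => ?_
    have htk := Finset.mem_range.mp ht
    rw [update_blockSite_sub y r' μ (u := t + 1) (by omega)]
    apply hA
    · exact Site.blockOf_blockSite hj y _
    · show blockOf ((Site.blockSite y (Function.update r' μ ⟨r' μ - (t + 1), _⟩)).shift μ) = y
      rw [← runSite_zero (Site.blockSite y (Function.update r' μ ⟨r' μ - (t + 1), _⟩)) μ, ← runSite_succ]
      exact blockOf_runSite_blockSite_of_lt hj y _ μ (by simp only [Function.update_self]; omega)

/-- THE FULL AVERAGE (1.8) AGREES WITH Q (1.11)/(2.13) ON BOND FIELDS SUPPORTED ON SURFACE BONDS: if `A` vanishes on every interior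
bond (both endpoints in one block) then the staircase legs `A(Γ_{c₋,x})`, `A(Γ_{x(c),c₊})` of (1.8) vanish (standing range).
[cite: Balaban1984PropagatorsI, (1.8) p.19] -/
theorem fullBondAvg_eq_bondAvg_of_interior (hj : j + 1 ≤ P.m + P.K) {V : Type*} [AddCommGroup V] [Module ℝ V]
    {A : VecField P j V}
    (hA : ∀ b : PBond P j, blockOf b.src = blockOf b.tgt → A b = 0) : fullBondAvg A = bondAvg A := by
  funext c
  unfold fullBondAvg bondAvg
  congr 1
  refine Finset.sum_congr rfl fun r _ => ?_
  rw [stairSum_eq_zero_of_interior hj c.src (fun b h1 h2 => hA b (h1.trans h2.symm)) r,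
    stairSum_eq_zero_of_interior hj c.tgt (fun b h1 h2 => hA b (h1.trans h2.symm)) r, zero_add, sub_zero]

/-- kernel: `Q^{s*}B` vanishes on interior bonds ((2.17), second case; `BlockBonds.not_mem_Bs_of_interior`).
[cite: BalabanImbrieJaffe1985, (2.17) p.304] -/
theorem Qsstar_of_interior (B : PBond P (j + 1) → ℝ) {b : PBond P j} (hb : blockOf b.src = blockOf b.tgt) :
    (torusBlockBonds P j).Qsstar B b = 0 :=
  (torusBlockBonds P j).Qsstar_of_not_mem B ((torusBlockBonds P j).not_mem_Bs_of_interior hb)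

/-- **(2.19)** for the FULL linear average `fullBondAvg` = [Balaban1984PropagatorsI] (1.8) (= (2.13) in the axial gauge): since
`Q^{s*}B` is supported on surface bonds, `fullBondAvg (Q^{s*}B) = bondAvg (Q^{s*}B) = B` on the tori (standing range).
[cite: BalabanImbrieJaffe1985, (2.19) p.305] -/
theorem fullBondAvg_Qsstar (hj : j + 1 ≤ P.m + P.K) (B : PBond P (j + 1) → ℝ) :
    fullBondAvg (V := ℝ) ((torusBlockBonds P j).Qsstar B) = B := by
  rw [fullBondAvg_eq_bondAvg_of_interior hj (fun b hb => Qsstar_of_interior B hb)]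
  exact bondAvg_Qsstar hj B

/-- **(2.19)** in the wording of `PHASE2-TARGETS.md` §G.3 (the bridge `fullBondAvg` ↔ `Cells.Qstar`): for the uniform cell carrier
(m = 1) and the full linear average, `fullBondAvg (Cells.Qstar B) = B` on the tori (standing range).
[cite: BalabanImbrieJaffe1985, (2.19) p.305] -/
theorem fullBondAvg_cellsQstar (hj : j + 1 ≤ P.m + P.K) (B : PBond P (j + 1) → ℝ) :
    fullBondAvg (V := ℝ) ((torusSurfaceCells P j).Qstar B) = B := by
  rw [cellsQstar_eq_Qsstar hj]
  exact fullBondAvg_Qsstar hj B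

end Literature.MathematicalPhysics.QuantumFieldTheory.BalabanImbrieJaffe1984to88.BIJ85Eq219ProofPart2
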